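import Summits.RiemannHypothesis.RiemannHypothesis.Theses.WeilComb
import Summits.RiemannHypothesis.RiemannHypothesis.Theorems.WeilCombCombShapeAdmissible
import Summits.RiemannHypothesis.RiemannHypothesis.Theorems.WeilCombCombShapePositivityArchOffdiag
import Literature.NumberTheory.LFunctions.WeilExplicit
import Literature.NumberTheory.LFunctions.WeilMellinBounds
import Literature.NumberTheory.LFunctions.WeilArchimedeanPositivityProofs
import Mathlib.Analysis.SpecificLimits.Basic

/-!
# Jensen's bound for the off-diagonal archimedean entries: `Re W_∞(τ_x ψ_ε) ≤ −I₀² g(x)`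
# (STUB-PLAN `stub_windowCore`, helper B1, upper half; stub `stub_archEntryJensen`)

Crux `WeilComb.CombShapePositivity` (item stmt-RiemannHypothesis-11229), line `Sketch`, STUB-PLAN
`stub_windowCore` Phase B, helper B1 (`arch_entry_bounds_window`, upper inequality). Notation:
`φ₀(u) = expNegInvGlue (1 − u²)`, `φ_ε = ε⁻¹ φ₀(·/ε)`, `ψ_ε = φ_ε ⋆ φ̃_ε`, `τ_x h = h(· − x)`,
`W_∞ = weilArchTerm`, `g(t) = e^{t/2}/(2 sinh t)`, `I₀ = ∫ φ₀`.

The landed `weilArchTerm_translate_psi_offdiag_bounds` (…ArchOffdiagBounds) sandwiches `Re W_∞(τ_x ψ_ε)`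
between `−I₀² g(x ∓ 2ε)` (monotonicity of `g`), which degenerates on the top cells (`x − 2ε → 0`). Here the
upper bound is sharpened to the window-uniform `−I₀² g(x)`:

* `hasSum_archWeight` — `g(t) = Σ_{k ≥ 0} e^{−(2k + ½)t}` for `t > 0` (geometric series);
* `archWeight_midpoint` — **midpoint convexity** `2 g(x) ≤ g(x + s) + g(x − s)` for `|s| < x`
  (termwise `e^{−cs} + e^{cs} ≥ 2`);
* `stub_archEntryJensen` (registered on the crux) — for `ε > 0`, `x > 2ε`:
  **`Re W_∞(τ_x ψ_ε) ≤ −I₀² g(x)`**: by Bombieri's form `W_∞(τ_x ψ_ε) = −∫₀^∞ g(t) P(t − x) dt` with the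
  real autocorrelation `P = f ⋆ f(−·)` of `f = ε⁻¹φ₀(·/ε)` (`P ≥ 0`, even, mass `I₀²`, support `[−2ε, 2ε]`), and
  `∫ g(x + s) P(s) ds = ½ ∫ (g(x+s) + g(x−s)) P(s) ds ≥ g(x) ∫ P` (Jensen).
-/

noncomputable section

-- the sub-problem path RiemannHypothesis/RiemannHypothesis duplicates a namespace (D-0017)
set_option linter.dupNamespace false

open scoped BigOperators ComplexConjugate Convolution
open Complex MeasureTheory Set

namespace Summit.RiemannHypothesis.RiemannHypothesis.Theorems.WeilCombArchJensen

open Literature.NumberTheory.LFunctions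
open Summit.RiemannHypothesis.RiemannHypothesis.Theorems.WeilCombBohrFejer
  (weilArchTerm_translate_psi_offdiag)

/-! ### The weight `g(t) = e^{t/2}/(2 sinh t)` as a series; midpoint convexity -/

/-- **`g(t) = Σ_{k ≥ 0} e^{−(2k + ½) t}` for `t > 0`** (`g(t) = e^{−t/2}/(1 − e^{−2t})`). [folklore] -/
theorem hasSum_archWeight {t : ℝ} (ht : 0 < t) :
    HasSum (fun k : ℕ ↦ Real.exp (-((2 * (k : ℝ) + 1 / 2) * t)))
      (Real.exp (t / 2) / (2 * Real.sinh t)) := by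
  have hr0 : 0 ≤ Real.exp (-(2 * t)) := (Real.exp_pos _).le
  have hr1 : Real.exp (-(2 * t)) < 1 := by rw [Real.exp_lt_one_iff]; linarith
  have h := (hasSum_geometric_of_lt_one hr0 hr1).mul_left (Real.exp (-(t / 2)))
  have hfun : (fun k : ℕ ↦ Real.exp (-((2 * (k : ℝ) + 1 / 2) * t))) =
      fun i : ℕ ↦ Real.exp (-(t / 2)) * Real.exp (-(2 * t)) ^ i := by
    funext k
    rw [← Real.exp_nat_mul, ← Real.exp_add]
    congr 1
    ring
  -- `e^{t/2}/(2 sinh t) = e^{−t/2} (1 − e^{−2t})⁻¹`, in terms of `a = e^{t/2}`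
  have hval : Real.exp (t / 2) / (2 * Real.sinh t) = Real.exp (-(t / 2)) * (1 - Real.exp (-(2 * t)))⁻¹ := by
    set a : ℝ := Real.exp (t / 2) with ha
    have ha0 : 0 < a := Real.exp_pos _
    have ha1 : 1 < a := by rw [ha]; exact Real.one_lt_exp_iff.2 (by linarith)
    have het : Real.exp t = a ^ 2 := by rw [ha, ← Real.exp_nat_mul]; congr 1; ring
    have hent : Real.exp (-t) = (a ^ 2)⁻¹ := by rw [Real.exp_neg, het]
    have hen2 : Real.exp (-(2 * t)) = (a ^ 4)⁻¹ := by
      rw [Real.exp_neg, show 2 * t = ((2 : ℕ) : ℝ) * t by norm_num, Real.exp_nat_mul, het]; ring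
    have henh : Real.exp (-(t / 2)) = a⁻¹ := by rw [Real.exp_neg, ha]
    rw [Real.sinh_eq, het, hent, hen2, henh]
    have h4 : a ^ 4 - 1 ≠ 0 := by
      have : 1 < a ^ 4 := one_lt_pow₀ ha1 (by norm_num)
      linarith
    have h2' : a ^ 2 - (a ^ 2)⁻¹ ≠ 0 := by
      have h21 : 1 < a ^ 2 := one_lt_pow₀ ha1 (by norm_num)
      have : (a ^ 2)⁻¹ < 1 := inv_lt_one_of_one_lt₀ h21
      linarith
    field_simp
  rw [hfun, hval]
  exact h

/-- **Midpoint convexity of the weight**: `2 g(x) ≤ g(x + s) + g(x − s)` for `|s| < x`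
(termwise in the series: `e^{−c(x+s)} + e^{−c(x−s)} − 2e^{−cx} = e^{−cx}(e^{−cs} + e^{cs} − 2) ≥ 0`). [folklore] -/
theorem archWeight_midpoint {x s : ℝ} (hs : |s| < x) :
    2 * (Real.exp (x / 2) / (2 * Real.sinh x)) ≤
      Real.exp ((x + s) / 2) / (2 * Real.sinh (x + s)) + Real.exp ((x - s) / 2) / (2 * Real.sinh (x - s)) := by
  have hx0 : 0 < x := lt_of_le_of_lt (abs_nonneg s) hs
  have hxs1 : 0 < x + s := by linarith [neg_abs_le s]
  have hxs2 : 0 < x - s := by linarith [le_abs_self s]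
  have h0 := hasSum_archWeight hx0
  have h1 := hasSum_archWeight hxs1
  have h2 := hasSum_archWeight hxs2
  have hsum := (h1.add h2).sub (h0.mul_left 2)
  have hnn : ∀ k : ℕ, 0 ≤ Real.exp (-((2 * (k : ℝ) + 1 / 2) * (x + s))) +
      Real.exp (-((2 * (k : ℝ) + 1 / 2) * (x - s))) - 2 * Real.exp (-((2 * (k : ℝ) + 1 / 2) * x)) := by
    intro k
    set c : ℝ := 2 * (k : ℝ) + 1 / 2 with hc
    have e1 : Real.exp (-(c * (x + s))) = Real.exp (-(c * x)) * Real.exp (-(c * s)) := by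
      rw [← Real.exp_add]; congr 1; ring
    have e2 : Real.exp (-(c * (x - s))) = Real.exp (-(c * x)) * Real.exp (c * s) := by
      rw [← Real.exp_add]; congr 1; ring
    rw [e1, e2]
    have hcosh : 2 ≤ Real.exp (-(c * s)) + Real.exp (c * s) := by
      have h := Real.one_le_cosh (c * s)
      rw [Real.cosh_eq] at h
      linarith
    have hpos : 0 ≤ Real.exp (-(c * x)) := (Real.exp_pos _).le
    nlinarith
  have := hsum.nonneg hnn
  linarith

/-- The weight is positive on `(0, ∞)`. [folklore] -/
private theorem archWeight_pos' {t : ℝ} (ht : 0 < t) : 0 < Real.exp (t / 2) / (2 * Real.sinh t) :=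
  div_pos (Real.exp_pos _) (mul_pos two_pos (Real.sinh_pos_iff.2 ht))

/-- The weight is decreasing on `(0, ∞)` (from the series, termwise). [folklore] -/
private theorem archWeight_anti {a b : ℝ} (ha : 0 < a) (hab : a ≤ b) :
    Real.exp (b / 2) / (2 * Real.sinh b) ≤ Real.exp (a / 2) / (2 * Real.sinh a) :=
  hasSum_le (fun k ↦ Real.exp_le_exp.2 (neg_le_neg (mul_le_mul_of_nonneg_left hab (by positivity))))
    (hasSum_archWeight (lt_of_lt_of_le ha hab)) (hasSum_archWeight ha)

/-! ### The real autocorrelation `P = f ⋆ f(−·)` of a real profile -/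

/-- For a real profile `φ = ↑f`: `φ ⋆ φ̃ = ↑(f ⋆ f(−·))` pointwise. [folklore] -/
private theorem weilConv_weilReflect_ofReal' (f : ℝ → ℝ) (s : ℝ) :
    weilConv (fun t : ℝ => ((f t : ℝ) : ℂ)) (weilReflect fun t : ℝ => ((f t : ℝ) : ℂ)) s =
      (((f ⋆[ContinuousLinearMap.mul ℝ ℝ, volume] (fun v => f (-v))) s : ℝ) : ℂ) := by
  rw [weilConv_apply, convolution_def, ← integral_complex_ofReal]
  congr 1 with u
  simp only [weilReflect, Complex.conj_ofReal, ContinuousLinearMap.mul_apply', Complex.ofReal_mul]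

/-- The autocorrelation of `f ≥ 0` is `≥ 0`. [folklore] -/
private theorem autocorr_nonneg' {f : ℝ → ℝ} (hf0 : ∀ t, 0 ≤ f t) (s : ℝ) :
    0 ≤ (f ⋆[ContinuousLinearMap.mul ℝ ℝ, volume] (fun v => f (-v))) s := by
  rw [convolution_def]
  exact integral_nonneg fun u => by
    simp only [Pi.zero_apply, ContinuousLinearMap.mul_apply']
    exact mul_nonneg (hf0 _) (hf0 _)

/-- The autocorrelation is even: `(f ⋆ f(−·))(−s) = (f ⋆ f(−·))(s)`. [folklore] -/
private theorem autocorr_even' (f : ℝ → ℝ) (s : ℝ) :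
    (f ⋆[ContinuousLinearMap.mul ℝ ℝ, volume] (fun v => f (-v))) (-s) =
      (f ⋆[ContinuousLinearMap.mul ℝ ℝ, volume] (fun v => f (-v))) s := by
  rw [convolution_def, convolution_def]
  simp only [ContinuousLinearMap.mul_apply']
  rw [← integral_sub_right_eq_self (fun t ↦ f t * f (-(-s - t))) s]
  refine integral_congr_ae (Filter.Eventually.of_forall fun t ↦ ?_)
  simp only
  rw [show -(-s - (t - s)) = t by ring, show -(s - t) = t - s by ring, mul_comm]

/-- If `supp f ⊆ [−ε, ε]` then `(f ⋆ f(−·))(s) = 0` for `|s| > 2ε`. [folklore] -/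
private theorem autocorr_eq_zero' {f : ℝ → ℝ} {ε s : ℝ} (hsupp : Function.support f ⊆ Icc (-ε) ε)
    (hs : 2 * ε < |s|) : (f ⋆[ContinuousLinearMap.mul ℝ ℝ, volume] (fun v => f (-v))) s = 0 := by
  rw [convolution_def]
  refine integral_eq_zero_of_ae (Filter.Eventually.of_forall fun u => ?_)
  simp only [ContinuousLinearMap.mul_apply', Pi.zero_apply]
  by_cases hu : f u = 0
  · rw [hu, zero_mul]
  · have hu' : u ∈ Icc (-ε) ε := hsupp hu
    have hv : f (-(s - u)) = 0 := by
      by_contra hv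
      have hv' : -(s - u) ∈ Icc (-ε) ε := hsupp hv
      rw [mem_Icc] at hu' hv'
      have : |s| ≤ 2 * ε := abs_le.2 ⟨by linarith, by linarith⟩
      linarith
    rw [hv, mul_zero]

/-- `∫ (f ⋆ f(−·)) = (∫ f)²` for integrable `f`. [folklore] -/
private theorem integral_autocorr' {f : ℝ → ℝ} (hfi : Integrable f) :
    ∫ s, (f ⋆[ContinuousLinearMap.mul ℝ ℝ, volume] (fun v => f (-v))) s = (∫ u, f u) ^ 2 := by
  rw [integral_convolution (L := ContinuousLinearMap.mul ℝ ℝ) hfi hfi.comp_neg,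
    ContinuousLinearMap.mul_apply', integral_neg_eq_self f volume, sq]

/-! ### Jensen for an even non-negative mass on `[−2ε, 2ε]` -/

/-- **Jensen step.** For `P ≥ 0` integrable, even, with `P(s) = 0` for `|s| > 2ε`, and `x > max(0, 2ε)`:
`(∫ P)·g(x) ≤ ∫₀^∞ g(t) P(t − x) dt` (`= ½∫(g(x+s) + g(x−s))P(s) ds`, midpoint convexity of `g`). [folklore] -/
private theorem archOffdiag_jensen {P : ℝ → ℝ} {ε x : ℝ} (hx0 : 0 < x) (hx : 2 * ε < x)
    (hPi : Integrable P) (hP0 : ∀ s, 0 ≤ P s) (hPev : ∀ s, P (-s) = P s)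
    (hPz : ∀ s, 2 * ε < |s| → P s = 0) :
    (∫ s, P s) * (Real.exp (x / 2) / (2 * Real.sinh x)) ≤
      ∫ t in Ioi (0 : ℝ), Real.exp (t / 2) / (2 * Real.sinh t) * P (t - x) := by
  set g : ℝ → ℝ := fun t ↦ Real.exp (t / 2) / (2 * Real.sinh t) with hg
  have hgm : Measurable g := by rw [hg]; fun_prop
  -- the window carrying `P`
  have hwin : ∀ s, P s ≠ 0 → |s| ≤ 2 * ε := fun s hs ↦ not_lt.1 fun h ↦ hs (hPz _ h)
  -- from the half line to the line, then translate: `∫₀^∞ g(t)P(t−x) dt = ∫ g(x+s)P(s) ds`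
  have hline : ∫ t in Ioi (0 : ℝ), g t * P (t - x) = ∫ s, g (x + s) * P s := by
    rw [setIntegral_eq_integral_of_forall_compl_eq_zero, ← integral_add_right_eq_self _ x]
    · refine integral_congr_ae (Filter.Eventually.of_forall fun s ↦ ?_)
      simp only
      rw [add_sub_cancel_right, add_comm]
    · intro t ht
      rw [mem_Ioi, not_lt] at ht
      rw [hPz _ (by rw [abs_of_neg (by linarith)]; linarith), mul_zero]
  -- reflect: `∫ g(x+s)P(s) ds = ∫ g(x−s)P(s) ds`
  have hrefl : ∫ s, g (x + s) * P s = ∫ s, g (x - s) * P s := by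
    rw [← integral_neg_eq_self (fun s ↦ g (x + s) * P s)]
    refine integral_congr_ae (Filter.Eventually.of_forall fun s ↦ ?_)
    simp only
    rw [hPev, ← sub_eq_add_neg]
  -- integrability of `g(x ± s) P(s)` (dominated by `g(x − 2ε) P(s)`)
  have hdom : ∀ s, ∀ y, |s| ≤ 2 * ε → (y = x + s ∨ y = x - s) → g y * P s ≤ g (x - 2 * ε) * P s := by
    intro s y hs hy
    refine mul_le_mul_of_nonneg_right ?_ (hP0 s)
    have hy' : x - 2 * ε ≤ y := by
      rcases hy with rfl | rfl <;> linarith [(abs_le.1 hs).1, (abs_le.1 hs).2]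
    exact archWeight_anti (by linarith) hy'
  have hint : ∀ (σ : ℝ), (σ = 1 ∨ σ = -1) → Integrable fun s ↦ g (x + σ * s) * P s := by
    intro σ hσ
    have hmeas : AEStronglyMeasurable (fun s ↦ g (x + σ * s) * P s) volume :=
      ((hgm.comp (by fun_prop : Measurable fun s : ℝ ↦ x + σ * s)).aestronglyMeasurable).mul
        hPi.aestronglyMeasurable
    refine Integrable.mono' (hPi.const_mul (g (x - 2 * ε))) hmeas
      (Filter.Eventually.of_forall fun s ↦ ?_)
    by_cases hPs : P s = 0
    · simp [hPs]
    · have hs := hwin s hPs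
      have hy : x + σ * s = x + s ∨ x + σ * s = x - s := by
        rcases hσ with rfl | rfl
        · left; ring
        · right; ring
      have hypos : 0 < x + σ * s := by
        rcases hy with h | h <;> rw [h] <;> linarith [(abs_le.1 hs).1, (abs_le.1 hs).2]
      rw [Real.norm_of_nonneg (mul_nonneg (archWeight_pos' hypos).le (hP0 s))]
      exact hdom s _ hs hy
  have hint1 : Integrable fun s ↦ g (x + s) * P s := by simpa using hint 1 (Or.inl rfl)
  have hint2 : Integrable fun s ↦ g (x - s) * P s := by
    simpa [sub_eq_add_neg] using hint (-1) (Or.inr rfl)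
  -- Jensen, pointwise then integrated
  have hpt : ∀ s, 2 * (g x * P s) ≤ g (x + s) * P s + g (x - s) * P s := by
    intro s
    by_cases hPs : P s = 0
    · simp [hPs]
    · have hs : |s| < x := lt_of_le_of_lt (hwin s hPs) hx
      have := archWeight_midpoint hs
      have hP := hP0 s
      nlinarith
  have hintL : Integrable fun s ↦ 2 * (g x * P s) := (hPi.const_mul (g x)).const_mul 2
  have hmono : ∫ s, 2 * (g x * P s) ≤ ∫ s, (g (x + s) * P s + g (x - s) * P s) :=
    integral_mono hintL (hint1.add hint2) hpt
  have hL : ∫ s, 2 * (g x * P s) = 2 * (g x * ∫ s, P s) := by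
    rw [integral_const_mul, integral_const_mul]
  have hR : ∫ s, (g (x + s) * P s + g (x - s) * P s) = 2 * ∫ s, g (x + s) * P s := by
    rw [integral_add hint1 hint2, ← hrefl]; ring
  simp only [hg] at hline hmono hL hR
  rw [hline]
  linarith

/-! ### The entry bound -/

/-- **Stub `stub_archEntryJensen` (B1, upper half; registered on crux stmt-RiemannHypothesis-11229).** For
`ε > 0` and `x > 2ε`, the off-diagonal archimedean entry of the fixed-shape comb satisfies the
window-uniform bound `Re W_∞(τ_x ψ_ε) ≤ −I₀²·e^{x/2}/(2 sinh x)` (Bombieri's kernel against the even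
non-negative autocorrelation of mass `I₀²` on `[x − 2ε, x + 2ε]`, Jensen by midpoint convexity of the kernel).
[folklore] -/
theorem stub_archEntryJensen : ∀ ε : ℝ, 0 < ε → ∀ x : ℝ, 2 * ε < x →
    (weilArchTerm (weilTranslate
        (weilConv (fun t : ℝ => (ε : ℂ)⁻¹ * ((expNegInvGlue (1 - (t / ε) ^ 2) : ℝ) : ℂ))
          (weilReflect (fun t : ℝ => (ε : ℂ)⁻¹ * ((expNegInvGlue (1 - (t / ε) ^ 2) : ℝ) : ℂ)))) x)).re ≤
      -((∫ u : ℝ, expNegInvGlue (1 - u ^ 2)) ^ 2 * (Real.exp (x / 2) / (2 * Real.sinh x))) := by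
  intro ε hε x hx
  have hx0 : 0 < x := lt_trans (by positivity) hx
  have hB := weilArchTerm_translate_psi_offdiag ε hε x (by rwa [abs_of_pos hx0])
  -- the real profile `f = ε⁻¹ φ₀(·/ε)` of `φ_ε = ↑f`
  set f : ℝ → ℝ := fun t => ε⁻¹ * expNegInvGlue (1 - (t / ε) ^ 2) with hf
  have hφ : (fun t : ℝ => (ε : ℂ)⁻¹ * ((expNegInvGlue (1 - (t / ε) ^ 2) : ℝ) : ℂ)) =
      fun t : ℝ => ((f t : ℝ) : ℂ) := by
    funext t
    simp only [hf, Complex.ofReal_mul, Complex.ofReal_inv]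
  rw [hφ] at hB ⊢
  have hf0 : ∀ t, 0 ≤ f t := fun t => mul_nonneg (inv_nonneg.2 hε.le) (expNegInvGlue.nonneg _)
  have hsupp : Function.support f ⊆ Icc (-ε) ε := by
    refine Function.support_subset_iff'.2 fun t ht => ?_
    have h1 : 1 - (t / ε) ^ 2 ≤ 0 := by
      rw [mem_Icc, not_and_or, not_le, not_le] at ht
      rcases ht with h | h
      · have h' : t / ε < -1 := by rw [div_lt_iff₀ hε]; linarith
        nlinarith
      · have h' : 1 < t / ε := by rw [lt_div_iff₀ hε]; linarith
        nlinarith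
    show ε⁻¹ * expNegInvGlue (1 - (t / ε) ^ 2) = 0
    rw [expNegInvGlue.zero_of_nonpos h1, mul_zero]
  have hfc : Continuous f := by
    rw [hf]
    exact continuous_const.mul ((expNegInvGlue.contDiff (n := 0)).continuous.comp
      (by fun_prop : Continuous fun t : ℝ => 1 - (t / ε) ^ 2))
  have hfi : Integrable f :=
    hfc.integrable_of_hasCompactSupport
      (HasCompactSupport.of_support_subset_isCompact isCompact_Icc hsupp)
  -- `∫ f = ∫ φ₀ = I₀` (dilation `t = ε u`)
  have hI : ∫ u, f u = ∫ u, expNegInvGlue (1 - u ^ 2) := by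
    simp only [hf]
    rw [integral_const_mul, Measure.integral_comp_div (fun u => expNegInvGlue (1 - u ^ 2)) ε,
      abs_of_pos hε, smul_eq_mul, ← mul_assoc, inv_mul_cancel₀ hε.ne', one_mul]
  -- the real autocorrelation `P`
  set P : ℝ → ℝ := f ⋆[ContinuousLinearMap.mul ℝ ℝ, volume] (fun v => f (-v)) with hP
  have hPz : ∀ s, 2 * ε < |s| → P s = 0 := fun s hs => autocorr_eq_zero' hsupp hs
  have hPi : Integrable P := hfi.integrable_convolution _ hfi.comp_neg
  have hPev : ∀ s, P (-s) = P s := fun s ↦ autocorr_even' f s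
  -- Bombieri's integral in real form
  have hreal : ∫ t in Ioi (0 : ℝ), (Real.exp (t / 2) : ℂ) *
      (weilTranslate (weilConv (fun t : ℝ => ((f t : ℝ) : ℂ)) (weilReflect fun t : ℝ => ((f t : ℝ) : ℂ))) x t +
        weilTranslate (weilConv (fun t : ℝ => ((f t : ℝ) : ℂ)) (weilReflect fun t : ℝ => ((f t : ℝ) : ℂ))) x (-t)) /
        (2 * Real.sinh t : ℂ) =
      ((∫ t in Ioi (0 : ℝ), Real.exp (t / 2) / (2 * Real.sinh t) * P (t - x) : ℝ) : ℂ) := by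
    rw [← integral_complex_ofReal]
    refine setIntegral_congr_fun measurableSet_Ioi fun t ht => ?_
    have ht' : 0 < t := ht
    have h0 : P (-t - x) = 0 := hPz _ (by rw [abs_of_neg (by linarith)]; linarith)
    simp only [weilTranslate, weilConv_weilReflect_ofReal' f, ← hP, h0]
    push_cast
    ring
  rw [hB, hreal, Complex.neg_re, Complex.ofReal_re]
  have hJ := archOffdiag_jensen hx0 hx hPi (autocorr_nonneg' hf0) hPev hPz
  rw [hP, integral_autocorr' hfi, hI] at hJ
  rw [hP]
  linarith

end Summit.RiemannHypothesis.RiemannHypothesis.Theorems.WeilCombArchJensen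

end
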